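/-
Copyright (c) 2026 the pub-hodgecm-mathlib formalisation cell (harness21).  Prover seat hodgecm-mathlib-F0P3a-p01 (g17): road «S3-ram» (LEAD F0P3a-plan (g13); owner∕table
F0P3a-p06 (g15)), the (a2) JUNCTION (J★) — THE HEAD, hypothesis-free: the socket text of the fold of record; 2026-09-02.
-/
import Literature.NumberTheory.Rogawski1990.DepthZeroKappaTransferTypeOneRamifiedSignedCountOfHyperbolic   -- ★ (β) (this seat, p848526): the head modulo the hyperbolic row
import Literature.NumberTheory.Rogawski1990.DepthZeroKappaTransferTypeOneRamifiedHyperbolicRegionTokens   -- ★ the S45 hyperbolic region row `isoceles_hyperbolic_regionCard_and_tokenCounts`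
import HarnessLib

/-!
# The ramified type-(1) `κ`-orbital integral: THE JUNCTION HEAD — the `κ`-signed five strata counts of the four ramified type-(1) literals (Rogawski 1990 §4.9;
# Kottwitz 1986 §3; Labesse–Langlands 1979 §2, §5)

Topic `NumberTheory/Rogawski1990`; namespace `Literature.NumberTheory.Rogawski1990`.  THEOREMS ONLY (no definition, no instance, no notation, no named fact, no `sorry`);
kernel lane `--supports stmt-HodgeConjecture-24833`; datum-free over the abstract lattice model.  Cell `pub/hodgecm-mathlib` (D-0151), crux H413; road «S3-ram» (Literature
seeding, count-neutral).  This file is the junction pen's statement-first v3 (`DepthZeroKappaTransferTypeOneRamifiedSignedCount.sf.v3`, R-308 «=») PROVED: the text is the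
`hJ` hypothesis type of ★ p847532 `typeOne_signedClassSum_ram_of_junction` (F0P3b-p01), `{K : Type}` first, binders VERBATIM.

* **`signedStrataCount_typeOne_ram`**: for the four ramified type-(1) literals `H_b = diag(ε^{b₁}u₀, ε^{b₂}u₁, ε^{b₁+b₂}u₂)` and the norm-one diagonal element
  `T = diag(α, u, γ) ≡ 1 (ϖ²)` with depths `N₁ + N₂ = 2m`, `N = 2n + 1`, `∀ j, Σ_b (−1)^{b₂}·n_{b,j} = χ((−1)^m·u₀u₂·A·C)·q^m·X̃_j(n)`,
  `X̃(n) = (4qⁿ, 4qⁿ⁻¹, 2(qⁿ−q−1)∕q², 2(qⁿ−q−1)∕q², 4(qⁿ−1)∕((q−1)q²))` — ★ (β) `signedStrataCount_typeOne_ram_of_hyperbolic` fed with the ★ hyperbolic region row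
  `isoceles_hyperbolic_regionCard_and_tokenCounts` BY NAME.
CONSUMPTION: `hJ := @signedStrataCount_typeOne_ram` closes the (J★) socket of ★ p847532.
HONEST LABEL: HC_CM is proved only modulo the 2 remaining named inputs (hLiu418 24832, h413 24833) until rung 0 closes; count-neutral Literature seeding.

## References
* [Rogawski1990] J. D. Rogawski, *Automorphic Representations of Unitary Groups in Three Variables*, Ann. of Math. Stud. 123 (1990), §4.9 Prop. 4.9.1 (a)(b) p. 55, Lemma 4.9.3.
* [Kottwitz1986] R. E. Kottwitz, *Base change for unit elements of Hecke algebras*, Compositio Math. 60 (1986), §3 (counting fixed lattices shell by shell).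
* [LabesseLanglands1979] J.-P. Labesse, R. P. Langlands, *L-indistinguishability for SL(2)*, Canad. J. Math. 31 (1979), §2 Lemma 2.1, §5 (κ-signed sums over the four twists).
-/

set_option autoImplicit false

noncomputable section

open scoped Valued WithZero Matrix MatrixGroups
open Polynomial Finset Classical
open Literature.NumberTheory.Automorphic Literature.NumberTheory.Automorphic.HermitianLattice Literature.NumberTheory.Automorphic.UnitaryLatticeTree

namespace Literature.NumberTheory.Rogawski1990

set_option maxHeartbeats 1600000 in
/-- **The (J★) junction head: the `κ`-signed five strata counts of the four ramified type-(1) literals** — `∀ j, Σ_b (−1)^{b₂}·n_{b,j} = χ((−1)^m·u₀u₂AC)·q^m·X̃_j(n)`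
for a norm-one diagonal `T = diag(α, u, γ) ≡ 1 (ϖ²)` with depths `N₁ + N₂ = 2m`, `N = 2n + 1`; ★ (β) ∘ ★ `isoceles_hyperbolic_regionCard_and_tokenCounts`.
[cite: Rogawski1990, §4.9 Prop. 4.9.1 (a) p. 55] [cite: Kottwitz1986, §3] [cite: LabesseLanglands1979, §2 Lemma 2.1] -/
theorem signedStrataCount_typeOne_ram
    {K : Type} [Field K] [Valued K ℤᵐ⁰] {σ : K →+* K} {ϖ : K}
    (hσ : ∀ x, σ (σ x) = x) (hvσ : ∀ a, Valued.v (σ a) = Valued.v a) (hϖ : Valued.v ϖ = WithZero.exp (-1 : ℤ)) (hσϖ : σ ϖ = -ϖ)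
    (hres : ∀ x : K, Valued.v x ≤ 1 → Valued.v (σ x - x) < 1) (h2 : Valued.v (2 : K) = 1)
    (hnorm : ∀ u : K, σ u = u → Valued.v (u - 1) < 1 → ∃ z : K, z * σ z = u ∧ Valued.v (z - 1) ≤ Valued.v (u - 1)) [Fintype 𝓀[K]] [DecidableEq 𝓀[K]]
    -- the torus datum: σ-fixed INTEGERS `u₀ u₁ u₂` (units), `ε` (a unit, residually a non-square), `c₀` (a unit, the rank-one class constant)
    (u₀ u₁ u₂ ε c₀ : 𝒪[K]) (hu₀ : Valued.v (u₀ : K) = 1) (hu₁ : Valued.v (u₁ : K) = 1) (hu₂ : Valued.v (u₂ : K) = 1) (hεv : Valued.v (ε : K) = 1) (hc₀ : Valued.v (c₀ : K) = 1)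
    (hσu₀ : σ u₀ = u₀) (hσu₁ : σ u₁ = u₁) (hσu₂ : σ u₂ = u₂) (hσε : σ ε = ε) (hσc₀ : σ c₀ = c₀)
    (hε : ¬ IsSquare (IsLocalRing.residue 𝒪[K] ε))
    -- the element: norm-one diagonal entries, `v`-deep (`≡ 1 (ϖ²)`), depths `N₁ = depth(α − u)`, `N₂ = depth(u − γ)` (`N₁ + N₂ = 2m`), `N = depth(α − γ) = 2n+1`, `n ≥ 1`,
    -- with the LEADING COEFFICIENTS `A = (α − u)∕ϖ^{N₁}`, `C = (γ − u)∕ϖ^{N₂}` (integers, units by `hN₁`, `hN₂`) that enter the sign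
    (α u γ : K) (hα : α * σ α = 1) (hu : u * σ u = 1) (hγ : γ * σ γ = 1)
    (hα2 : Valued.v (α - 1) ≤ Valued.v ϖ ^ 2) (hu2 : Valued.v (u - 1) ≤ Valued.v ϖ ^ 2) (hγ2 : Valued.v (γ - 1) ≤ Valued.v ϖ ^ 2)
    (T : GL (Fin 3) K) (hT : (T : Matrix (Fin 3) (Fin 3) K) = Matrix.diagonal ![α, u, γ])
    (N₁ N₂ N m n : ℕ) (hN₁ : Valued.v (α - u) = Valued.v ϖ ^ N₁) (hN₂ : Valued.v (u - γ) = Valued.v ϖ ^ N₂) (hN : Valued.v (α - γ) = Valued.v ϖ ^ N)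
    (hm : N₁ + N₂ = 2 * m) (hn : N = 2 * n + 1) (h1n : 1 ≤ n)
    (A C : 𝒪[K]) (hA : α - u = (A : K) * ϖ ^ N₁) (hC : γ - u = (C : K) * ϖ ^ N₂) :
    ∀ j : Fin 5,
      ∑ b : Fin 2 × Fin 2, (-1 : ℚ) ^ (b.2 : ℕ) *
        (({M : Submodule 𝒪[K] (Fin 3 → K) |
            IsSelfDualLattice σ ϖ (Matrix.diagonal ![((ε : K)) ^ (b.1 : ℕ) * (u₀ : K), (ε : K) ^ (b.2 : ℕ) * (u₁ : K), (ε : K) ^ ((b.1 : ℕ) + (b.2 : ℕ)) * (u₂ : K)]) M ∧ mapGL T M = M ∧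
              (![-- bd : `¬ (T − 1)M ⊆ ϖM`
                  ¬ M.map ((Matrix.toLin' ((T : Matrix (Fin 3) (Fin 3) K) - 1)).restrictScalars 𝒪[K]) ≤ scaleLattice ϖ M,
                -- reg : depth 1, rank 2
                  M.map ((Matrix.toLin' ((T : Matrix (Fin 3) (Fin 3) K) - 1)).restrictScalars 𝒪[K]) ≤ scaleLattice ϖ M ∧
                    ¬ M.map ((Matrix.toLin' ((T : Matrix (Fin 3) (Fin 3) K) - 1)).restrictScalars 𝒪[K]) ≤ scaleLattice (ϖ ^ 2) M ∧
                    ¬ M.map ((Matrix.toLin' (((T : Matrix (Fin 3) (Fin 3) K) - 1) ^ 2)).restrictScalars 𝒪[K]) ≤ scaleLattice (ϖ ^ 3) M,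
                -- 1s : depth 1, rank 1, class `c₀`
                  M.map ((Matrix.toLin' ((T : Matrix (Fin 3) (Fin 3) K) - 1)).restrictScalars 𝒪[K]) ≤ scaleLattice ϖ M ∧
                    ¬ M.map ((Matrix.toLin' ((T : Matrix (Fin 3) (Fin 3) K) - 1)).restrictScalars 𝒪[K]) ≤ scaleLattice (ϖ ^ 2) M ∧
                    M.map ((Matrix.toLin' (((T : Matrix (Fin 3) (Fin 3) K) - 1) ^ 2)).restrictScalars 𝒪[K]) ≤ scaleLattice (ϖ ^ 3) M ∧
                    ∃ y ∈ M, ∃ a : K, Valued.v a = 1 ∧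
                      Valued.v (ϖ⁻¹ * pairing σ (Matrix.diagonal ![((ε : K)) ^ (b.1 : ℕ) * (u₀ : K), (ε : K) ^ (b.2 : ℕ) * (u₁ : K), (ε : K) ^ ((b.1 : ℕ) + (b.2 : ℕ)) * (u₂ : K)]) y
                        (((T : Matrix (Fin 3) (Fin 3) K) - 1) *ᵥ y) - (c₀ : K) * a ^ 2) < 1,
                -- 1n : depth 1, rank 1, class `c₀·ε`
                  M.map ((Matrix.toLin' ((T : Matrix (Fin 3) (Fin 3) K) - 1)).restrictScalars 𝒪[K]) ≤ scaleLattice ϖ M ∧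
                    ¬ M.map ((Matrix.toLin' ((T : Matrix (Fin 3) (Fin 3) K) - 1)).restrictScalars 𝒪[K]) ≤ scaleLattice (ϖ ^ 2) M ∧
                    M.map ((Matrix.toLin' (((T : Matrix (Fin 3) (Fin 3) K) - 1) ^ 2)).restrictScalars 𝒪[K]) ≤ scaleLattice (ϖ ^ 3) M ∧
                    ∃ y ∈ M, ∃ a : K, Valued.v a = 1 ∧
                      Valued.v (ϖ⁻¹ * pairing σ (Matrix.diagonal ![((ε : K)) ^ (b.1 : ℕ) * (u₀ : K), (ε : K) ^ (b.2 : ℕ) * (u₁ : K), (ε : K) ^ ((b.1 : ℕ) + (b.2 : ℕ)) * (u₂ : K)]) y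
                        (((T : Matrix (Fin 3) (Fin 3) K) - 1) *ᵥ y) - (c₀ : K) * (ε : K) * a ^ 2) < 1,
                -- 0 : depth ≥ 2
                  M.map ((Matrix.toLin' ((T : Matrix (Fin 3) (Fin 3) K) - 1)).restrictScalars 𝒪[K]) ≤ scaleLattice (ϖ ^ 2) M] : Fin 5 → Prop) j}.ncard : ℕ) : ℚ) =
        ((quadraticChar 𝓀[K] (IsLocalRing.residue 𝒪[K] ((-1) ^ m * (u₀ * u₂ * A * C))) : ℤ) : ℚ) * (Fintype.card 𝓀[K] : ℚ) ^ m *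
          (![4 * (Fintype.card 𝓀[K] : ℚ) ^ n, 4 * (Fintype.card 𝓀[K] : ℚ) ^ (n - 1), (2 * ((Fintype.card 𝓀[K] : ℚ) ^ n - Fintype.card 𝓀[K] - 1)) / (Fintype.card 𝓀[K] : ℚ) ^ 2,
              (2 * ((Fintype.card 𝓀[K] : ℚ) ^ n - Fintype.card 𝓀[K] - 1)) / (Fintype.card 𝓀[K] : ℚ) ^ 2,
              (4 * ((Fintype.card 𝓀[K] : ℚ) ^ n - 1)) / (((Fintype.card 𝓀[K] : ℚ) - 1) * (Fintype.card 𝓀[K] : ℚ) ^ 2)] : Fin 5 → ℚ) j :=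
  signedStrataCount_typeOne_ram_of_hyperbolic (@isoceles_hyperbolic_regionCard_and_tokenCounts K _ _ σ ϖ)
    hσ hvσ hϖ hσϖ hres h2 hnorm u₀ u₁ u₂ ε c₀ hu₀ hu₁ hu₂ hεv hc₀ hσu₀ hσu₁ hσu₂ hσε hσc₀ hε α u γ hα hu hγ hα2 hu2 hγ2 T hT
    N₁ N₂ N m n hN₁ hN₂ hN hm hn h1n A C hA hC

end Literature.NumberTheory.Rogawski1990

end
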